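import Summits.Ventures.PackingBounds.Configurations.CL17
import Summits.Ventures.PackingBounds.Kissing.DimensionNine
import Summits.Ventures.PackingBounds.Kissing.DimensionTen
import Summits.Ventures.PackingBounds.Kissing.DimensionEleven
import Summits.Ventures.PackingBounds.Kissing.DimensionTwelve

/-!
# Kissing configurations from Construction A: `κ(9) ≥ 306`, `κ(10) ≥ 500`, `κ(11) ≥ 582`, `κ(12) ≥ 840`

Framing: lottery ticket; floor = certified bounds/negative ranges. Venture `PackingBounds` (cell
`pub-packcert`, seat `pub-packcert-energy`).

Leech and Sloane's Construction A packings `P₉ₐ, P₁₀b, P₁₁c, P₁₂ₐ` (Conway–Sloane, *SPLAG* Ch. 5 §2.6, Table 1.2)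
have spheres touching `2n + 16 · A₄` others, where `A₄` is the number of weight-`4` codewords at distance `4` from a
fixed codeword: around the centre the `2n` vectors `±2 e_i` and, for every such weight-`4` word `w`, the `16` vectors
`(±1)` on the support of `w` (all of norm `4`, pairwise inner products `≤ 2` because two of the words share `≤ 2`
cells). This file proves the GENERIC statement — `N` four-element subsets of `{0, …, n−1}` pairwise meeting in at
most two points give a kissing configuration of `16 N + 2n` unit vectors in `ℝⁿ` (`exists_kissing_consA`; the
vectors are the pattern vectors `pvec` of `CL17Vectors.lean` with all `16` sign patterns, the block facts are
kernel-checked bit counts) — and instantiates it with explicit optimal constant-weight codes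
`A(9,4,4) = 18`, `A(10,4,4) = 30`, `A(11,4,4) = 35`, `A(12,4,4) = 51` (found by search, seat file
`code/cw_search.py`): **`κ(9) ≥ 306`, `κ(10) ≥ 500`, `κ(11) ≥ 582`, `κ(12) ≥ 840`**, the values of SPLAG Table 1.2
(`306` and `840` are the records at the time of writing; `500`, `582` have since been superseded by `510`, `593`).

## References
* J. H. Conway, N. J. A. Sloane, *Sphere Packings, Lattices and Groups*, Ch. 5 §2.6 and Table 1.2. [`ConwaySloane1999`]
-/

namespace Summit.Ventures.PackingBounds.Config.ConsA

open Finset Leech Golay CL17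

/-- A word `< 2ⁿ` is supported on the coordinates `< n`. -/
theorem val_lt_of_mem_supp_lt {m n : ℕ} (hm : m < 2 ^ n) {j : Fin 24} (hj : j ∈ supp m) : j.val < n := by
  by_contra h
  have h2 : 2 ^ n ≤ 2 ^ j.val := Nat.pow_le_pow_right (by norm_num) (by omega)
  have := Nat.testBit_eq_false_of_lt (lt_of_lt_of_le hm h2)
  simp [supp, this] at hj

/-! ### The vectors -/

/-- The `16` sign patterns on the block `S`: `(±1)` on `S`, indexed by the subset `T ⊆ S` of minus signs. -/
def blockVecs (S : Finset (Fin 24)) : Finset (Fin 24 → ℤ) :=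
  S.powerset.image fun T => pvec S (fun j => decide (j ∈ T)) 1 0

/-- The `2n` vectors `±2 e_j`, `j < n`. -/
def pointVecs (n : ℕ) : Finset (Fin 24 → ℤ) :=
  ((univ.filter fun j : Fin 24 => j.val < n) ×ˢ (univ : Finset Bool)).image fun q => pvec {q.1} (fun _ => q.2) 2 0

/-- **Construction A kissing configuration** around a centre: the blocks `blk b`, `b < N`, with all signs, and the
`2n` axis vectors. [cite: ConwaySloane1999, Ch. 5 §2.6] -/
def consA (n N : ℕ) (blk : ℕ → ℕ) : Finset (Fin 24 → ℤ) :=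
  (range N).biUnion (fun b => blockVecs (supp (blk b))) ∪ pointVecs n

/-- Members of `blockVecs S`. -/
theorem mem_blockVecs {S : Finset (Fin 24)} {x : Fin 24 → ℤ} :
    x ∈ blockVecs S ↔ ∃ T ⊆ S, x = pvec S (fun j => decide (j ∈ T)) 1 0 := by
  simp only [blockVecs, mem_image, mem_powerset]
  constructor
  · rintro ⟨T, hT, rfl⟩; exact ⟨T, hT, rfl⟩
  · rintro ⟨T, hT, rfl⟩; exact ⟨T, hT, rfl⟩

/-- Members of `pointVecs n`. -/
theorem mem_pointVecs {n : ℕ} {x : Fin 24 → ℤ} :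
    x ∈ pointVecs n ↔ ∃ j : Fin 24, ∃ c : Bool, j.val < n ∧ x = pvec {j} (fun _ => c) 2 0 := by
  simp only [pointVecs, mem_image, mem_product, mem_filter, mem_univ, true_and, and_true, Prod.exists]
  constructor
  · rintro ⟨j, c, hj, rfl⟩; exact ⟨j, c, hj, rfl⟩
  · rintro ⟨j, c, hj, rfl⟩; exact ⟨j, c, hj, rfl⟩

/-! ### Counting -/

/-- `|blockVecs S| = 2^{|S|}` (`S ⊆ cells`). -/
theorem card_blockVecs {S : Finset (Fin 24)} (hS : S ⊆ cells) : (blockVecs S).card = 2 ^ S.card := by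
  rw [blockVecs, card_image_of_injOn, card_powerset]
  intro T hT T' hT' h
  simp only [coe_powerset, Set.mem_preimage, Set.mem_powerset_iff, coe_subset] at hT hT'
  obtain ⟨hf, -⟩ := pvec_eq_pvec hS (by norm_num : (1 : ℤ) ≠ 0) h
  ext j
  constructor
  · intro hj; have := hf j (hT hj); simpa [hj] using this
  · intro hj; have := hf j (hT' hj); simpa [hj] using this

/-- Block vectors are nonzero exactly on their block. -/
theorem nz_of_mem_blockVecs {S : Finset (Fin 24)} (hS : S ⊆ cells) {x : Fin 24 → ℤ} (hx : x ∈ blockVecs S) :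
    (cells.filter fun j => x j ≠ 0) = S := by
  obtain ⟨T, _, rfl⟩ := mem_blockVecs.mp hx
  exact nz_pvec_eq hS _ (by norm_num) 0

/-- `|pointVecs n| = 2n` (`n ≤ 16`). -/
theorem card_pointVecs {n : ℕ} (hn : n ≤ 16) : (pointVecs n).card = 2 * n := by
  rw [pointVecs, card_image_of_injOn, card_product, card_filter_val_lt (by omega), Finset.card_univ,
    Fintype.card_bool, mul_comm]
  rintro ⟨j, c⟩ hq ⟨j', c'⟩ hq' h
  simp only [coe_product, Set.mem_prod, mem_coe, mem_filter, mem_univ, true_and] at hq hq'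
  change pvec {j} (fun _ => c) 2 0 = pvec {j'} (fun _ => c') 2 0 at h
  have hj : ({j} : Finset (Fin 24)) ⊆ cells := by
    intro i hi; rw [Finset.mem_singleton] at hi; subst hi; exact mem_cells.mpr (by omega)
  have hj' : ({j'} : Finset (Fin 24)) ⊆ cells := by
    intro i hi; rw [Finset.mem_singleton] at hi; subst hi; exact mem_cells.mpr (by omega)
  have hs : ({j} : Finset (Fin 24)) = {j'} := by
    rw [← nz_pvec_eq hj (fun _ => c) (by norm_num : (2 : ℤ) ≠ 0) 0,
      ← nz_pvec_eq hj' (fun _ => c') (by norm_num : (2 : ℤ) ≠ 0) 0, h]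
  have hjj : j = j' := Finset.singleton_injective hs
  subst hjj
  obtain ⟨hf, -⟩ := pvec_eq_pvec hj (by norm_num : (2 : ℤ) ≠ 0) h
  rw [hf j (Finset.mem_singleton_self j)]

section Blocks

variable {n N : ℕ} {blk : ℕ → ℕ}

/-- Supports of the blocks are cells. -/
theorem supp_blk_sub (hn : n ≤ 16) (hblk : ∀ b < N, popK 24 24 (blk b) = 4 ∧ blk b < 2 ^ n) {b : ℕ} (hb : b < N) :
    supp (blk b) ⊆ cells :=
  fun _ hj => mem_cells.mpr (lt_of_lt_of_le (val_lt_of_mem_supp_lt (hblk b hb).2 hj) hn)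

/-- Blocks have `4` cells. -/
theorem card_supp_blk (hblk : ∀ b < N, popK 24 24 (blk b) = 4 ∧ blk b < 2 ^ n) {b : ℕ} (hb : b < N) :
    (supp (blk b)).card = 4 := by
  have h := (hblk b hb).1
  rw [← wt_eq_popK] at h; exact h

/-- Distinct blocks meet in `≤ 2` cells. -/
theorem card_blk_inter (hint : ∀ b < N, ∀ b' < N, b = b' ∨ popK 24 24 (blk b &&& blk b') ≤ 2) {b b' : ℕ}
    (hb : b < N) (hb' : b' < N) (hne : b ≠ b') : (supp (blk b) ∩ supp (blk b')).card ≤ 2 := by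
  rw [card_supp_inter]
  rcases hint b hb b' hb' with h | h
  · exact absurd h hne
  · exact h

/-- **`|consA| = 16 N + 2n`.** -/
theorem card_consA (hn : n ≤ 16) (hblk : ∀ b < N, popK 24 24 (blk b) = 4 ∧ blk b < 2 ^ n)
    (hint : ∀ b < N, ∀ b' < N, b = b' ∨ popK 24 24 (blk b &&& blk b') ≤ 2) :
    (consA n N blk).card = 16 * N + 2 * n := by
  have hdisj : ∀ b ∈ range N, ∀ b' ∈ range N, b ≠ b' →
      Disjoint (blockVecs (supp (blk b))) (blockVecs (supp (blk b'))) := by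
    intro b hb b' hb' hne
    rw [mem_range] at hb hb'
    rw [Finset.disjoint_left]
    intro x hx hx'
    have h1 := nz_of_mem_blockVecs (supp_blk_sub hn hblk hb) hx
    have h2 := nz_of_mem_blockVecs (supp_blk_sub hn hblk hb') hx'
    have h3 := card_blk_inter hint hb hb' hne
    rw [← h1.symm.trans h2, Finset.inter_self, card_supp_blk hblk hb] at h3
    omega
  have hAP : Disjoint ((range N).biUnion fun b => blockVecs (supp (blk b))) (pointVecs n) := by
    rw [Finset.disjoint_left]
    intro x hx hx'
    obtain ⟨b, hb, hxb⟩ := mem_biUnion.mp hx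
    rw [mem_range] at hb
    have h1 := nz_of_mem_blockVecs (supp_blk_sub hn hblk hb) hxb
    obtain ⟨j, c, hj, rfl⟩ := mem_pointVecs.mp hx'
    have hjc : ({j} : Finset (Fin 24)) ⊆ cells := by
      intro i hi; rw [Finset.mem_singleton] at hi; subst hi; exact mem_cells.mpr (by omega)
    rw [nz_pvec_eq hjc _ (by norm_num) 0] at h1
    have := card_supp_blk hblk hb
    rw [← h1, Finset.card_singleton] at this
    omega
  rw [consA, card_union_of_disjoint hAP, card_biUnion hdisj, card_pointVecs hn]
  rw [Finset.sum_congr rfl fun b hb => by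
    rw [card_blockVecs (supp_blk_sub hn hblk (mem_range.mp hb)), card_supp_blk hblk (mem_range.mp hb)]]
  simp [mul_comm]

/-! ### Norms and inner products -/

/-- Every vector is a pattern vector on at most `4` cells `< n`, with axis value `0` and norm `4`. -/
theorem exists_pvec_of_mem_consA (hn : n ≤ 16) (hblk : ∀ b < N, popK 24 24 (blk b) = 4 ∧ blk b < 2 ^ n)
    {x : Fin 24 → ℤ} (hx : x ∈ consA n N blk) :
    ∃ S : Finset (Fin 24), ∃ f : Fin 24 → Bool, ∃ a : ℤ, (∀ j ∈ S, j.val < n) ∧ x = pvec S f a 0 ∧ ip x x = 4 := by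
  rw [consA, mem_union] at hx
  rcases hx with hx | hx
  · obtain ⟨b, hb, hxb⟩ := mem_biUnion.mp hx
    rw [mem_range] at hb
    obtain ⟨T, _, rfl⟩ := mem_blockVecs.mp hxb
    refine ⟨_, _, _, fun j hj => val_lt_of_mem_supp_lt (hblk b hb).2 hj, rfl, ?_⟩
    rw [ip_pvec_self (supp_blk_sub hn hblk hb), card_supp_blk hblk hb]; norm_num
  · obtain ⟨j, c, hj, rfl⟩ := mem_pointVecs.mp hx
    have hjc : ({j} : Finset (Fin 24)) ⊆ cells := by
      intro i hi; rw [Finset.mem_singleton] at hi; subst hi; exact mem_cells.mpr (by omega)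
    refine ⟨_, _, _, fun i hi => by rw [Finset.mem_singleton] at hi; subst hi; exact hj, rfl, ?_⟩
    rw [ip_pvec_self hjc, Finset.card_singleton]; norm_num

/-- **Pairwise inner products `≤ 2`** (half the norm). -/
theorem ip_le_of_mem_consA (hn : n ≤ 16) (hblk : ∀ b < N, popK 24 24 (blk b) = 4 ∧ blk b < 2 ^ n)
    (hint : ∀ b < N, ∀ b' < N, b = b' ∨ popK 24 24 (blk b &&& blk b') ≤ 2)
    {x y : Fin 24 → ℤ} (hx : x ∈ consA n N blk) (hy : y ∈ consA n N blk) (hne : x ≠ y) : ip x y ≤ 2 := by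
  have hcell : ∀ j : Fin 24, j.val < n → ({j} : Finset (Fin 24)) ⊆ cells := fun j hj i hi => by
    rw [Finset.mem_singleton] at hi; subst hi; exact mem_cells.mpr (by omega)
  -- same support, different signs: the formula with `D ≥ 1`
  have hsame : ∀ (S : Finset (Fin 24)) (hS : S ⊆ cells) (f f' : Fin 24 → Bool) (a : ℤ),
      pvec S f a 0 ≠ pvec S f' a 0 → a * a * S.card ≤ 4 → 1 ≤ a * a →
      ip (pvec S f a 0) (pvec S f' a 0) ≤ 2 := by
    intro S hS f f' a hne' hcard ha1
    have hne2 : ∃ j ∈ S, f j ≠ f' j := by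
      by_contra hall
      push Not at hall
      exact hne' (pvec_congr hall a 0)
    obtain ⟨j, hj, hfj⟩ := hne2
    rw [ip_pvec_pvec hS hS, Finset.inter_self]
    have hpos : (1 : ℤ) ≤ ((S.filter fun j => (f j ^^ f' j) = true).card : ℤ) := by
      have : 0 < (S.filter fun j => (f j ^^ f' j) = true).card := by
        apply Finset.card_pos.mpr
        refine ⟨j, Finset.mem_filter.mpr ⟨hj, ?_⟩⟩
        revert hfj; cases f j <;> cases f' j <;> simp
      exact_mod_cast this
    have key : 0 ≤ (a * a - 1) * (((S.filter fun j => (f j ^^ f' j) = true).card : ℤ) - 1) :=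
      mul_nonneg (by linarith) (by linarith)
    nlinarith [key]
  rw [consA, mem_union] at hx hy
  rcases hx with hx | hx <;> rcases hy with hy | hy
  · obtain ⟨b, hb, hxb⟩ := mem_biUnion.mp hx
    obtain ⟨b', hb', hyb⟩ := mem_biUnion.mp hy
    rw [mem_range] at hb hb'
    obtain ⟨T, _, rfl⟩ := mem_blockVecs.mp hxb
    obtain ⟨T', _, rfl⟩ := mem_blockVecs.mp hyb
    by_cases hbb : b = b'
    · subst hbb
      exact hsame _ (supp_blk_sub hn hblk hb) _ _ 1 hne (by rw [card_supp_blk hblk hb]; norm_num) (by norm_num)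
    · have h := ip_pvec_pvec_le_inter (supp_blk_sub hn hblk hb) (supp_blk_sub hn hblk hb')
        (fun j => decide (j ∈ T)) (fun j => decide (j ∈ T')) (by norm_num : (0 : ℤ) ≤ 1 * 1) 0 0
      have h2 : ((supp (blk b) ∩ supp (blk b')).card : ℤ) ≤ 2 := by exact_mod_cast card_blk_inter hint hb hb' hbb
      linarith
  · obtain ⟨b, hb, hxb⟩ := mem_biUnion.mp hx
    rw [mem_range] at hb
    obtain ⟨T, _, rfl⟩ := mem_blockVecs.mp hxb
    obtain ⟨j, c, hj, rfl⟩ := mem_pointVecs.mp hy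
    have h := ip_pvec_pvec_le_inter (supp_blk_sub hn hblk hb) (hcell j hj) (fun j => decide (j ∈ T)) (fun _ => c)
      (by norm_num : (0 : ℤ) ≤ 1 * 2) 0 0
    have h1 : ((supp (blk b) ∩ {j}).card : ℤ) ≤ 1 := by
      exact_mod_cast (Finset.card_le_card Finset.inter_subset_right).trans (by simp)
    linarith
  · obtain ⟨j, c, hj, rfl⟩ := mem_pointVecs.mp hx
    obtain ⟨b, hb, hyb⟩ := mem_biUnion.mp hy
    rw [mem_range] at hb
    obtain ⟨T, _, rfl⟩ := mem_blockVecs.mp hyb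
    have h := ip_pvec_pvec_le_inter (hcell j hj) (supp_blk_sub hn hblk hb) (fun _ => c) (fun j => decide (j ∈ T))
      (by norm_num : (0 : ℤ) ≤ 2 * 1) 0 0
    have h1 : ((({j} : Finset (Fin 24)) ∩ supp (blk b)).card : ℤ) ≤ 1 := by
      exact_mod_cast (Finset.card_le_card Finset.inter_subset_left).trans (by simp)
    linarith
  · obtain ⟨j, c, hj, rfl⟩ := mem_pointVecs.mp hx
    obtain ⟨j', c', hj', rfl⟩ := mem_pointVecs.mp hy
    by_cases hjj : j = j'
    · subst hjj
      exact hsame _ (hcell j hj) _ _ 2 hne (by rw [Finset.card_singleton]; norm_num) (by norm_num)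
    · have h := ip_pvec_pvec_le_inter (hcell j hj) (hcell j' hj') (fun _ => c) (fun _ => c')
        (by norm_num : (0 : ℤ) ≤ 2 * 2) 0 0
      rw [Finset.singleton_inter_of_notMem (by rwa [Finset.mem_singleton]), Finset.card_empty] at h
      push_cast at h
      linarith

/-! ### Transfer to `ℝⁿ` -/

/-- **Construction A, generic**: `N` four-subsets of `{0,…,n-1}` (`n ≤ 16`) pairwise meeting in at most two points
give a kissing configuration of `16 N + 2 n` unit vectors in `ℝⁿ`. [cite: ConwaySloane1999, Ch. 5 §2.6] -/
theorem exists_kissing_consA (hn : n ≤ 16) (hblk : ∀ b < N, popK 24 24 (blk b) = 4 ∧ blk b < 2 ^ n)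
    (hint : ∀ b < N, ∀ b' < N, b = b' ∨ popK 24 24 (blk b &&& blk b') ≤ 2) :
    ∃ C : Finset (EuclideanSpace ℝ (Fin n)), C.card = 16 * N + 2 * n ∧ (∀ x ∈ C, ‖x‖ = 1) ∧
      (∀ x ∈ C, ∀ y ∈ C, x ≠ y → inner ℝ x y ≤ 1 / 2) := by
  set K := (consA n N blk).image (toE 4) with hK
  have hKc : K.card = 16 * N + 2 * n := by
    rw [hK, card_image_of_injective _ (toE_injective (by norm_num)), card_consA hn hblk hint]
  have hKn : ∀ p ∈ K, ‖p‖ = 1 := by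
    intro p hp
    obtain ⟨x, hx, rfl⟩ := mem_image.mp hp
    obtain ⟨S, f, a, -, -, h4⟩ := exists_pvec_of_mem_consA hn hblk hx
    exact norm_toE (by norm_num) (by rw [h4]; norm_num)
  have hKi : ∀ p ∈ K, ∀ q ∈ K, p ≠ q → inner ℝ p q ≤ 1 / 2 := by
    intro p hp q hq hpq
    obtain ⟨x, hx, rfl⟩ := mem_image.mp hp
    obtain ⟨y, hy, rfl⟩ := mem_image.mp hq
    have hxy : x ≠ y := fun h => hpq (by rw [h])
    rw [inner_toE (by norm_num), div_le_iff₀ (by norm_num)]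
    have h : (ip x y : ℝ) ≤ 2 := by exact_mod_cast ip_le_of_mem_consA hn hblk hint hx hy hxy
    linarith
  have hKo : ∀ p ∈ K, ∀ i : Fin (24 - n),
      inner ℝ (EuclideanSpace.single (⟨n + i.val, by omega⟩ : Fin 24) (1 : ℝ)) p = 0 := by
    intro p hp i
    obtain ⟨x, hx, rfl⟩ := mem_image.mp hp
    obtain ⟨S, f, a, hS, rfl, -⟩ := exists_pvec_of_mem_consA hn hblk hx
    rw [EuclideanSpace.inner_single_left, map_one, one_mul, toE_apply]
    have hj : (⟨n + i.val, by omega⟩ : Fin 24) ∉ S := fun h => by have := hS _ h; simp at this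
    simp [pvec, hj]
  obtain ⟨C', hc, hno, hi, _⟩ := exists_transfer_orthogonal (m := 24) (n := n) (k := 24 - n) (by omega)
    (fun i : Fin (24 - n) => EuclideanSpace.single (⟨n + i.val, by omega⟩ : Fin 24) (1 : ℝ))
    (linearIndependent_tail n (24 - n) (by omega)) K hKo
  refine ⟨C', by rw [hc, hKc], fun x' hx' => ?_, fun x' hx' y' hy' hne => ?_⟩
  · obtain ⟨x, hx, he⟩ := hno x' hx'
    rw [he]; exact hKn x hx
  · obtain ⟨x, hx, y, hy, hxy, he⟩ := hi x' hx' y' hy' hne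
    rw [he]; exact hKi x hx y hy hxy

end Blocks

/-! ### The four explicit block systems -/

/-- `18` four-subsets of `{0..8}` pairwise meeting in `≤ 2` points (`A(9,4,4) = 18`), as bit masks. -/
def blk9 (b : ℕ) : ℕ :=
  match b with
  | 0 => 45 | 1 => 51 | 2 => 86 | 3 => 89 | 4 => 106 | 5 => 135 | 6 => 154 | 7 => 180 | 8 => 204 | 9 => 225
  | 10 => 270 | 11 => 277 | 12 => 312 | 13 => 323 | 14 => 356 | 15 => 393 | 16 => 418 | 17 => 464
  | _ => 0

/-- `30` four-subsets of `{0..9}` pairwise meeting in `≤ 2` points (a Steiner system `S(3,4,10)`), as bit masks. -/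
def blk10 (b : ℕ) : ℕ :=
  match b with
  | 0 => 27 | 1 => 39 | 2 => 85 | 3 => 108 | 4 => 114 | 5 => 142 | 6 => 169 | 7 => 180 | 8 => 195 | 9 => 216
  | 10 => 284 | 11 => 298 | 12 => 305 | 13 => 326 | 14 => 329 | 15 => 389 | 16 => 402 | 17 => 480 | 18 => 525
  | 19 => 534 | 20 => 568 | 21 => 586 | 22 => 609 | 23 => 657 | 24 => 674 | 25 => 708 | 26 => 771 | 27 => 804
  | 28 => 848 | 29 => 904
  | _ => 0

/-- `35` four-subsets of `{0..10}` pairwise meeting in `≤ 2` points (`A(11,4,4) = 35`), as bit masks. -/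
def blk11 (b : ℕ) : ℕ :=
  match b with
  | 0 => 43 | 1 => 53 | 2 => 108 | 3 => 135 | 4 => 154 | 5 => 201 | 6 => 226 | 7 => 270 | 8 => 312 | 9 => 325
  | 10 => 338 | 11 => 401 | 12 => 420 | 13 => 525 | 14 => 534 | 15 => 579 | 16 => 624 | 17 => 680 | 18 => 708
  | 19 => 801 | 20 => 840 | 21 => 898 | 22 => 1043 | 23 => 1094 | 24 => 1112 | 25 => 1121 | 26 => 1164
  | 27 => 1200 | 28 => 1289 | 29 => 1314 | 30 => 1472 | 31 => 1546 | 32 => 1572 | 33 => 1665 | 34 => 1808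
  | _ => 0

/-- `51` four-subsets of `{0..11}` pairwise meeting in `≤ 2` points (`A(12,4,4) = 51`, Leech–Sloane's `A₄(c) = 51`
for `P₁₂ₐ`), as bit masks. -/
def blk12 (b : ℕ) : ℕ :=
  match b with
  | 0 => 29 | 1 => 71 | 2 => 90 | 3 => 150 | 4 => 165 | 5 => 170 | 6 => 201 | 7 => 240 | 8 => 270 | 9 => 291
  | 10 => 340 | 11 => 360 | 12 => 401 | 13 => 523 | 14 => 556 | 15 => 562 | 16 => 593 | 17 => 708 | 18 => 773
  | 19 => 792 | 20 => 834 | 21 => 928 | 22 => 1080 | 23 => 1122 | 24 => 1155 | 25 => 1164 | 26 => 1289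
  | 27 => 1298 | 28 => 1316 | 29 => 1472 | 30 => 1542 | 31 => 1569 | 32 => 1608 | 33 => 1680 | 34 => 2067
  | 35 => 2086 | 36 => 2089 | 37 => 2124 | 38 => 2200 | 39 => 2242 | 40 => 2352 | 41 => 2369 | 42 => 2436
  | 43 => 2580 | 44 => 2656 | 45 => 2689 | 46 => 3077 | 47 => 3082 | 48 => 3152 | 49 => 3232 | 50 => 3840
  | _ => 0

/-- Block facts for `n = 9`. -/
theorem blk9_facts : (∀ b < 18, popK 24 24 (blk9 b) = 4 ∧ blk9 b < 2 ^ 9) ∧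
    ∀ b < 18, ∀ b' < 18, b = b' ∨ popK 24 24 (blk9 b &&& blk9 b') ≤ 2 := by
  constructor <;> decide +kernel

set_option maxRecDepth 100000 in
/-- Block facts for `n = 10`. -/
theorem blk10_facts : (∀ b < 30, popK 24 24 (blk10 b) = 4 ∧ blk10 b < 2 ^ 10) ∧
    ∀ b < 30, ∀ b' < 30, b = b' ∨ popK 24 24 (blk10 b &&& blk10 b') ≤ 2 := by
  constructor <;> decide +kernel

set_option maxRecDepth 100000 in
/-- Block facts for `n = 11`. -/
theorem blk11_facts : (∀ b < 35, popK 24 24 (blk11 b) = 4 ∧ blk11 b < 2 ^ 11) ∧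
    ∀ b < 35, ∀ b' < 35, b = b' ∨ popK 24 24 (blk11 b &&& blk11 b') ≤ 2 := by
  constructor <;> decide +kernel

set_option maxRecDepth 100000 in
/-- Block facts for `n = 12`. -/
theorem blk12_facts : (∀ b < 51, popK 24 24 (blk12 b) = 4 ∧ blk12 b < 2 ^ 12) ∧
    ∀ b < 51, ∀ b' < 51, b = b' ∨ popK 24 24 (blk12 b &&& blk12 b') ≤ 2 := by
  constructor <;> decide +kernel

/-! ### The theorems -/

/-- **`κ(9) ≥ 306`** (`P₉ₐ`; the record lower bound in dimension `9` at the time of writing).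
[cite: ConwaySloane1999, Table 1.2] -/
theorem exists_kissing_306 : ∃ C : Finset (EuclideanSpace ℝ (Fin 9)),
    C.card = 306 ∧ (∀ x ∈ C, ‖x‖ = 1) ∧ (∀ x ∈ C, ∀ y ∈ C, x ≠ y → inner ℝ x y ≤ 1 / 2) :=
  exists_kissing_consA (N := 18) (by norm_num) blk9_facts.1 blk9_facts.2

/-- **`κ(10) ≥ 500`** (`P₁₀b`; the record is `510`, Ganzhinov 2022). [cite: ConwaySloane1999, Table 1.2] -/
theorem exists_kissing_500 : ∃ C : Finset (EuclideanSpace ℝ (Fin 10)),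
    C.card = 500 ∧ (∀ x ∈ C, ‖x‖ = 1) ∧ (∀ x ∈ C, ∀ y ∈ C, x ≠ y → inner ℝ x y ≤ 1 / 2) :=
  exists_kissing_consA (N := 30) (by norm_num) blk10_facts.1 blk10_facts.2

/-- **`κ(11) ≥ 582`** (`P₁₁c`; the record is `593`, AlphaEvolve 2025). [cite: ConwaySloane1999, Table 1.2] -/
theorem exists_kissing_582 : ∃ C : Finset (EuclideanSpace ℝ (Fin 11)),
    C.card = 582 ∧ (∀ x ∈ C, ‖x‖ = 1) ∧ (∀ x ∈ C, ∀ y ∈ C, x ≠ y → inner ℝ x y ≤ 1 / 2) :=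
  exists_kissing_consA (N := 35) (by norm_num) blk11_facts.1 blk11_facts.2

/-- **`κ(12) ≥ 840`** (`P₁₂ₐ`; the record lower bound in dimension `12` at the time of writing).
[cite: ConwaySloane1999, Ch. 5 §2.6, Table 1.2] -/
theorem exists_kissing_840 : ∃ C : Finset (EuclideanSpace ℝ (Fin 12)),
    C.card = 840 ∧ (∀ x ∈ C, ‖x‖ = 1) ∧ (∀ x ∈ C, ∀ y ∈ C, x ≠ y → inner ℝ x y ≤ 1 / 2) :=
  exists_kissing_consA (N := 51) (by norm_num) blk12_facts.1 blk12_facts.2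

/-- **`306 ≤ κ(9) ≤ 380`** (Delsarte LP certificate of the cell). -/
theorem kissing_dim9_bracket :
    (∃ C : Finset (EuclideanSpace ℝ (Fin 9)), C.card = 306 ∧ (∀ x ∈ C, ‖x‖ = 1) ∧
      (∀ x ∈ C, ∀ y ∈ C, x ≠ y → inner ℝ x y ≤ 1 / 2)) ∧
    ∀ C : Finset (EuclideanSpace ℝ (Fin 9)), (∀ x ∈ C, ‖x‖ = 1) →
      (∀ x ∈ C, ∀ y ∈ C, x ≠ y → inner ℝ x y ≤ 1 / 2) → C.card ≤ 380 :=
  ⟨exists_kissing_306, Kissing.kissing_dim9_le_380⟩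

/-- **`840 ≤ κ(12) ≤ 1416`** (Delsarte LP certificate of the cell). -/
theorem kissing_dim12_bracket :
    (∃ C : Finset (EuclideanSpace ℝ (Fin 12)), C.card = 840 ∧ (∀ x ∈ C, ‖x‖ = 1) ∧
      (∀ x ∈ C, ∀ y ∈ C, x ≠ y → inner ℝ x y ≤ 1 / 2)) ∧
    ∀ C : Finset (EuclideanSpace ℝ (Fin 12)), (∀ x ∈ C, ‖x‖ = 1) →
      (∀ x ∈ C, ∀ y ∈ C, x ≠ y → inner ℝ x y ≤ 1 / 2) → C.card ≤ 1416 :=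
  ⟨exists_kissing_840, Kissing.kissing_dim12_le_1416⟩

end Summit.Ventures.PackingBounds.Config.ConsA
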